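import Mathlib
import HarnessLib
import Summits.HubbardSuperconductivity.HubbardSuperconductivity.Theorems.KLProgrammeKLRegimeEngineLadderLocalisation

/-!
# Route `KLProgramme` — crux K3, ENGINE child `KLRegimeEngineV11` (stmt-HubbardSuperconductivity-19823): the EXACT one-slice ladder as
# `𝒞_{n−1}·N_z` with the TRUE aggregated weights (the bridge under the Δ21 repairs), and the signed-mass bookkeeping
# `Σz⁻ ≤ Σ|z − z₀|`, `(Σ‖w‖) − Re Σw ≤ 2·Σ‖w − w₀‖`

Cell gate-hubbard-kl, seat hubbard-kl-k3c1-p1 (g2); sequel to p463012 `…EngineLadderLocalisation`.  CANDIDATE Δ21 (p1 g6 STATUS 19:39:51Z, this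
seat 20:0xZ, HOME/hubbard-kl-k3c1-p1/DELTA21-PHI.md): the true slice pair weights at an edge-zone pair-class momentum have an n-INDEPENDENT
negative-mass fraction (φ ≈ 0.2), so the `w ≥ 0` model of (E2-v7) costs `O(U²·φ)` per edge scale through `klpli_*`'s transfer term — not inside the
decaying budget at deep scales.  Both repairs on the table read the SAME two facts from this file:
* (R-w / R-w′: complex model weights, `w := z`) **`klell_localised_ladder_rightInverse`** — as `klell_localised_ladder`, but returning the RIGHT
  INVERSE: `∃ N, (1 + diag z·C)·N = 1 = N·(1 + diag z·C)` for the aggregated `z_s = Σ_b z′_(s,b)`, with `|T_K(x,y) − (C·N)(x.1,y.1)| ≤` the four-term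
  localisation bound and the entry bounds `|(C N)(s,t)| ≤ (3/2)m`, `|(C N − C)(s,t)| ≤ (3/2)m·(m·Σ_s|z_s|)` — so a clause quantifying over complex `w`
  with `Σ‖w‖ ≤ bhi` is met by the exact ladder with ZERO transfer cost (remainder = non-ladder + localisation only);
* (net-mass and negative-mass clauses, either repair) `klpli_negPart_sum_le_sum_abs_sub` (real `z`, reference `z₀ ≥ 0`: `Σ_s max(−z_s) 0 ≤ Σ_s |z_s − z₀_s|`)
  and `klpli_norm_sum_sub_re_sum_le` (complex `w`, reference `w₀` real `≥ 0`: `(Σ‖w‖) − Re(Σ w) ≤ 2·Σ‖w − w₀‖`) — the signed mass of the slice weights at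
  total momentum `Q` is controlled by their `Q`-LIPSCHITZ distance to the `Q = 0` weights `β⁻¹Σ_ν|ĝ_n|² ≥ 0` (a propagator-level estimate), no sign
  analysis of Matsubara sums needed.
Pure algebra / order bookkeeping; nothing about the model is asserted.  0 kit.
-/

noncomputable section

namespace Summit.HubbardSuperconductivity.HubbardSuperconductivity.Theorems.KLRegimeSplit

set_option linter.dupNamespace false -- summit = problem name (single-conjunct summit), D-0017

open Finset Matrix Literature.MathematicalPhysics.QuantumLattice Literature.Probability.LatticeModels
open Summit.HubbardSuperconductivity.HubbardSuperconductivity.Theorems.KLProgrammeCooperResummation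

/-! ## §1 The exact aggregated ladder with its right inverse -/

section Compose

variable {S F : Type*} [Fintype S] [DecidableEq S] [Nonempty S] [Fintype F] [DecidableEq F] [Nonempty F]

/-- **The localised ladder, right-inverse form.**  `C` on `S` with `|C| ≤ m`; `K` on `S × F` with `|K| ≤ m′`; weights `z′` on `S × F` with
`m·Σ|z′| ≤ 1/3`, `m′·Σ|z′| ≤ 1/3`; `T_K` the `K`-ladder sum.  With the AGGREGATED weights `z_s = Σ_b z′_(s,b)` there is a two-sided inverse `N` of
`1 + diag z·C` with `|(C N)(s,t)| ≤ (3/2)m`, `|(C N − C)(s,t)| ≤ (3/2)m·(m·Σ_s|z_s|)`, and for all `x y : S × F` the four-term localisation bound on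
`|T_K(x,y) − (C N)(x.1,y.1)|` (entries `E(x,y) = K(x,y) − C(x.1,y.1)`). -/
theorem klell_localised_ladder_rightInverse (C : Matrix S S ℂ) (K : Matrix (S × F) (S × F) ℂ) (z' : S × F → ℂ) {m m' : ℝ}
    (hm : 0 ≤ m) (hm' : 0 ≤ m') (hC : ∀ s t, ‖C s t‖ ≤ m) (hK : ∀ x y, ‖K x y‖ ≤ m')
    (hzC : m * ∑ x, ‖z' x‖ ≤ 1 / 3) (hzK : m' * ∑ x, ‖z' x‖ ≤ 1 / 3)
    (TK : Matrix (S × F) (S × F) ℂ) (hTK : HasSum (fun j : ℕ => K * (-(Matrix.diagonal z' * K)) ^ j) TK) :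
    ∃ N : Matrix S S ℂ,
      (1 + Matrix.diagonal (fun s => ∑ b, z' (s, b)) * C) * N = 1 ∧ N * (1 + Matrix.diagonal (fun s => ∑ b, z' (s, b)) * C) = 1 ∧
      (∀ s t, ‖(C * N) s t‖ ≤ 3 / 2 * m) ∧
      (∀ s t, ‖(C * N - C) s t‖ ≤ 3 / 2 * m * (m * ∑ s, ‖∑ b, z' (s, b)‖)) ∧
      ∀ x y : S × F,
        ‖TK x y - (C * N) x.1 y.1‖ ≤ ‖K x y - C x.1 y.1‖ +
          3 / 2 * m * ∑ b, ‖K x b - C x.1 b.1‖ * ‖z' b‖ +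
          3 / 2 * m' * ∑ a, ‖z' a‖ * ‖K a y - C a.1 y.1‖ +
          9 / 4 * m' * m * ∑ a, ∑ b, ‖z' a‖ * ‖K a b - C a.1 b.1‖ * ‖z' b‖ := by
  set z : S → ℂ := fun s => ∑ b, z' (s, b) with hz_def
  have hzS : m * ∑ s, ‖z s‖ ≤ 1 / 3 :=
    (mul_le_mul_of_nonneg_left (klell_sum_norm_aggregate_le z') hm).trans hzC
  obtain ⟨N, -, hN1, hN2, -, -, -, -, -, hCN, hCNC, -⟩ := klcrs_single_slice z hm C hC hzS
  have hT := (klcrs_single_slice_ladder_hasSum z hm C hC hzS N hN1).2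
  obtain ⟨T, hT', hbd⟩ := klell_localised_ladder C K z' hm hm' hC hK hzC hzK TK hTK
  have hTT : T = C * N := hT'.unique hT
  refine ⟨N, hN1, hN2, hCN, hCNC, fun x y => ?_⟩
  have h := hbd x y
  rw [hTT] at h
  exact h

end Compose

/-! ## §2 Signed-mass bookkeeping against a nonnegative reference -/

section Mass

variable {S : Type*} [Fintype S]

/-- **Negative mass against a nonnegative reference.**  For real weights `z` and a reference `z₀ ≥ 0` (the `Q = 0` slice weights):
`Σ_s max(−z_s) 0 ≤ Σ_s |z_s − z₀_s|`. -/
theorem klpli_negPart_sum_le_sum_abs_sub (z z₀ : S → ℝ) (hz₀ : ∀ s, 0 ≤ z₀ s) :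
    ∑ s, max (-z s) 0 ≤ ∑ s, |z s - z₀ s| := by
  refine sum_le_sum fun s _ => max_le ?_ (abs_nonneg _)
  have h1 : z₀ s - z s ≤ |z s - z₀ s| := by rw [abs_sub_comm]; exact le_abs_self _
  linarith [hz₀ s]

/-- **Non-positive mass of complex weights against a nonnegative real reference.**  For `w : S → ℂ` and `w₀ : S → ℝ` with `w₀ ≥ 0`:
`(Σ_s ‖w_s‖) − Re(Σ_s w_s) ≤ 2·Σ_s ‖w_s − w₀_s‖` (so `Re Σ w ≥ −(2Σ‖w − w₀‖ − Σ‖w‖)` and in particular `Re Σ w ≥ Σ‖w‖ − 2Σ‖w − w₀‖`). -/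
theorem klpli_norm_sum_sub_re_sum_le (w : S → ℂ) (w₀ : S → ℝ) (hw₀ : ∀ s, 0 ≤ w₀ s) :
    (∑ s, ‖w s‖) - (∑ s, w s).re ≤ 2 * ∑ s, ‖w s - (w₀ s : ℂ)‖ := by
  rw [Complex.re_sum, two_mul, ← sub_nonneg]
  have key : ∀ s, ‖w s‖ - (w s).re ≤ ‖w s - (w₀ s : ℂ)‖ + ‖w s - (w₀ s : ℂ)‖ := by
    intro s
    have h1 : ‖w s‖ ≤ ‖(w₀ s : ℂ)‖ + ‖w s - (w₀ s : ℂ)‖ := by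
      calc ‖w s‖ = ‖(w₀ s : ℂ) + (w s - (w₀ s : ℂ))‖ := by rw [add_sub_cancel]
        _ ≤ ‖(w₀ s : ℂ)‖ + ‖w s - (w₀ s : ℂ)‖ := norm_add_le _ _
    have h2 : (w₀ s : ℝ) - (w s).re ≤ ‖w s - (w₀ s : ℂ)‖ := by
      calc (w₀ s : ℝ) - (w s).re = ((w₀ s : ℂ) - w s).re := by simp
        _ ≤ ‖(w₀ s : ℂ) - w s‖ := Complex.re_le_norm _
        _ = ‖w s - (w₀ s : ℂ)‖ := norm_sub_rev _ _
    have h3 : ‖(w₀ s : ℂ)‖ = w₀ s := by rw [Complex.norm_real, Real.norm_eq_abs, abs_of_nonneg (hw₀ s)]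
    linarith
  have := sum_le_sum fun s (_ : s ∈ (univ : Finset S)) => key s
  rw [sum_sub_distrib, sum_add_distrib] at this
  linarith

/-- **Net mass lower bound.**  Same data: `Re(Σ w) ≥ (Σ‖w₀‖)·1 − Σ‖w − w₀‖`, stated as `(Σ_s w₀_s) − Σ_s ‖w_s − w₀_s‖ ≤ Re(Σ_s w_s)`. -/
theorem klpli_re_sum_ge_reference_sub (w : S → ℂ) (w₀ : S → ℝ) :
    (∑ s, w₀ s) - ∑ s, ‖w s - (w₀ s : ℂ)‖ ≤ (∑ s, w s).re := by
  rw [Complex.re_sum, ← sub_nonneg]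
  have key : ∀ s, w₀ s - ‖w s - (w₀ s : ℂ)‖ ≤ (w s).re := by
    intro s
    have h2 : (w₀ s : ℝ) - (w s).re ≤ ‖w s - (w₀ s : ℂ)‖ := by
      calc (w₀ s : ℝ) - (w s).re = ((w₀ s : ℂ) - w s).re := by simp
        _ ≤ ‖(w₀ s : ℂ) - w s‖ := Complex.re_le_norm _
        _ = ‖w s - (w₀ s : ℂ)‖ := norm_sub_rev _ _
    linarith
  have := sum_le_sum fun s (_ : s ∈ (univ : Finset S)) => key s
  rw [sum_sub_distrib] at this
  linarith

end Mass

end Summit.HubbardSuperconductivity.HubbardSuperconductivity.Theorems.KLRegimeSplit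

end
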